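import Literature.Topology.FourManifolds.ThetaFourKervaireMilnorHomologyStep
import Literature.Topology.FourManifolds.SphereSurgeryOddMiddleRank
import Literature.Topology.FourManifolds.SphereSurgeryOddMiddleIsotropy
import HarnessLib

/-!
# Kervaire–Milnor Theorem 5.1 (`k = 2`): Lemma 5.8 discharged — the frontier is Theorem 5.5 and
# Lemmas 5.3–5.4

Topic `Literature/Topology/FourManifolds`; sequel of `ThetaFourKervaireMilnorHomologyStep.lean` for
the named fact
`Literature.Topology.FourManifolds.HomotopySphere.boundsContractible_of_nullCobordism_isStablyParallelizable_four`
(M. Kervaire, J. Milnor, *Groups of homotopy spheres I*, Ann. of Math. (2) 77 (1963), Thm. 5.1 at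
`k = 2`). There the reduction
`HomotopySphere.boundsContractible_of_nullCobordism_isStablyParallelizable_four_of_surgeryLemmas`
(`ThetaFourKervaireMilnorSurgeryProofs.lean`) was brought down to the three inputs Thm. 5.5
(`h55`), Lemmas 5.3–5.4 (`h534`) and **Lemma 5.8** (`h58`: for `W⁵` compact simply connected with
`∂W` a homotopy `4`-sphere, a spherical modification of type `(3, 3)` changes the second Betti
number). This file DISCHARGES `h58`:

* `SphereSurgeryOddMiddleRank.lean` proves Lemma 5.8 from the isotropy `(ISO)` of the torus of the
  modification (`NullCobordism.finrank_surgery_ne_of_iso`: the two exact sequences of Lemma 5.6,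
  the rank book-keeping `rank (G/x(Z)) = rank G - [x of infinite order]`, and the duality
  computation `μ · λ = ⟨α, λ⟩`);
* `SphereSurgeryOddMiddleIsotropy.lean` proves `(ISO)` for `k` even
  (`FramedSphereFamily.mul_eq_zero_of_zsmul_parallel_eq_zsmul_meridian`: Thom's isotropy theorem
  through Čech–Alexander duality in the external collar, `TubeComplementDuality.lean`, and the
  cohomology ring of `S² × S²`);
* here `Hᵏ(∂W; ℤ) = 0` is read off the homotopy `2k`-sphere `∂W ≃ S²ᵏ` (universal coefficients,
  `kroneckerPairing_bijective_of_isZero`), and a generator of `Hₖ(Sᵏ; ℤ)` is the fundamental class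
  (`SphereProd.exists_eq_smul_fundamentalClass_sphere`), giving **Lemma 5.8 as printed, for every
  even `k ≥ 2`**: `NullCobordism.finrank_surgery_ne_of_even` (also the hypothesis `h58` of
  `HomotopySphere.exists_killMiddleHomology_of_surgeryLemmas_even`, `HCobordismThetaFiniteKMSurgery.lean`);

* `HomotopySphere.boundsContractible_of_nullCobordism_isStablyParallelizable_four_of_surgeryLemmas_geometric`
  — **Thm. 5.1 (`k = 2`) from Thm. 5.5 and Lemmas 5.3–5.4 alone.**

Everything here is proved; no definition and no named fact is introduced (D-0026).

## References

* M. Kervaire, J. Milnor, *Groups of homotopy spheres I*, Ann. of Math. (2) 77 (1963), Thm. 5.1,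
  Thm. 5.5, Lemmas 5.3–5.4, 5.6–5.8 (pp. 513–518). doi:10.2307/1970128 [KervaireMilnorAnnals1963]
* R. Thom, *Espaces fibrés en sphères et carrés de Steenrod*, Ann. Sci. ENS 69 (1952), Thm. V.10.
  [Thom1952]
* A. Hatcher, *Algebraic Topology*, CUP 2002, Thm. 3.2, Cor. 2.14. [HatcherAT2002]
-/

noncomputable section

open scoped Manifold ContDiff Topology
open Set Function CategoryTheory CategoryTheory.Limits AddSubgroup
open Literature.AlgebraicTopology.SingularHomology

namespace Literature.Topology.FourManifolds

/-- For a null-cobordism `W` of a homotopy `2k`-sphere (`k ≥ 2`), `Hᵏ(∂W; ℤ) = 0`: `∂W ≃ S²ᵏ` has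
`Hₖ₋₁ = Hₖ = 0`, and universal coefficients (`Hᵏ ↪ Hom(Hₖ, ℤ)` when `Hₖ₋₁ = 0`).
[cite: HatcherAT2002, Thm. 3.2 and Cor. 2.14] -/
theorem NullCobordism.isZero_singularCohomology_boundary {k : ℕ} (hk : 2 ≤ k)
    (S : HomotopySphere (k + k)) (c : NullCobordism.{0} (k + k) S.carrier) :
    IsZero (singularCohomology ℤ ℤ ↥((𝓡∂ (k + k + 1)).boundary c.W) k) := by
  obtain ⟨j, rfl⟩ : ∃ j, k = j + 1 := ⟨k - 1, by omega⟩
  let e : ↥((𝓡∂ (j + 1 + (j + 1) + 1)).boundary c.W) ≃ₜ S.carrier :=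
    (c.isSmoothEmbedding_incl.isEmbedding.toHomeomorph.trans (Homeomorph.setCongr c.range_incl)).symm
  let hE := e.toHomotopyEquiv.trans S.nonempty_homotopyEquiv.some
  have h1 : IsZero (singularHomology ℤ ℤ ↥((𝓡∂ (j + 1 + (j + 1) + 1)).boundary c.W) j) :=
    (isZero_singularHomology_sphere_holds ℤ ℤ (by omega) (by omega)).of_iso
      (singularHomology.isoOfHomotopyEquiv ℤ ℤ hE j)
  have h2 : IsZero (singularHomology ℤ ℤ ↥((𝓡∂ (j + 1 + (j + 1) + 1)).boundary c.W) (j + 1)) :=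
    (isZero_singularHomology_sphere_holds ℤ ℤ (by omega) (by omega)).of_iso
      (singularHomology.isoOfHomotopyEquiv ℤ ℤ hE (j + 1))
  have hb := kroneckerPairing_bijective_of_isZero ℤ (↥((𝓡∂ (j + 1 + (j + 1) + 1)).boundary c.W)) j h1
  haveI := ModuleCat.subsingleton_of_isZero h2
  haveI : Subsingleton ↥(singularCohomology ℤ ℤ ↥((𝓡∂ (j + 1 + (j + 1) + 1)).boundary c.W) (j + 1)) :=
    hb.1.subsingleton
  exact ModuleCat.isZero_of_subsingleton _

/-- The fundamental class generates `H₂(S²; ℤ)`. [cite: HatcherAT2002, Thm. 3.26(a)] -/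
theorem SphereProd.zmultiples_fundamentalClass_eq_top {k : ℕ} (hk : 2 ≤ k) :
    zmultiples (SphereProd.μS hk).fundamentalClass = ⊤ := by
  rw [AddSubgroup.eq_top_iff']
  intro z
  obtain ⟨c, hc⟩ := SphereProd.exists_eq_smul_fundamentalClass_sphere hk z
  exact mem_zmultiples_iff.2 ⟨c, hc.symm⟩

/-- **Kervaire–Milnor's Lemma 5.8** (*Groups of homotopy spheres I*, p. 516): under the Hypothesis
of p. 516 — `W` a compact, simply connected (s-parallelizability is not used) smooth
`(2k+1)`-manifold whose boundary is a homotopy `2k`-sphere — *"if `k` is even then the modification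
`χ(φ)` necessarily changes the `k`-th Betti number"* of `W`, for every framed imbedded `k`-sphere
`φ : Sᵏ × Dᵏ⁺¹ ↪ W`: `rank Hₖ(χ(W, φ); ℤ) ≠ rank Hₖ(W; ℤ)`. Proof (not the printed one, which
goes through the semi-characteristic of the `(2k+2)`-dimensional trace, Lemma 5.9, pp. 517–518):
`NullCobordism.finrank_surgery_ne_of_iso` (the two exact sequences of Lemma 5.6 and the duality
`μ · λ = ⟨α, λ⟩` of p. 516) with the isotropy `(ISO)` of the torus
(`FramedSphereFamily.mul_eq_zero_of_zsmul_parallel_eq_zsmul_meridian`: Thom's isotropy theorem for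
`M₀`, `k` even), `Hᵏ(∂W) = 0` and the fundamental class generating `Hₖ(Sᵏ)`.
[cite: KervaireMilnorAnnals1963, Lemma 5.8 (p. 516)] [cite: Thom1952, Thm. V.10] -/
theorem NullCobordism.finrank_surgery_ne_of_even {k : ℕ} (hk : 2 ≤ k) (hke : Even k)
    (S : HomotopySphere (k + k)) (c : NullCobordism.{0} (k + k) S.carrier) [SimplyConnectedSpace c.W]
    (ν : FramedSphereFamily (𝓡∂ (k + k + 1)) c.W Unit k (k + 1)) :
    Module.finrank ℤ (singularHomology ℤ ℤ (c.surgery ν rfl).W k) ≠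
      Module.finrank ℤ (singularHomology ℤ ℤ c.W k) :=
  NullCobordism.finrank_surgery_ne_of_iso S c ν rfl hk
    (SphereProd.zmultiples_fundamentalClass_eq_top hk) (SphereProd.southPole k)
    SphereProd.quarter_southPole_ne_zero SphereProd.norm_quarter_southPole_lt_one
    fun m m' hrel =>
      FramedSphereFamily.mul_eq_zero_of_zsmul_parallel_eq_zsmul_meridian ν rfl hk hke
        (NullCobordism.isZero_singularCohomology_boundary hk S c)
        (SphereProd.zmultiples_fundamentalClass_eq_top hk) m m' hrel

namespace HomotopySphere

/-- **Kervaire–Milnor's Theorem 5.1 for `k = 2` from Theorem 5.5 and Lemmas 5.3–5.4 alone**: the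
homological inputs of the reduction
`boundsContractible_of_nullCobordism_isStablyParallelizable_four_of_surgeryLemmas` — Lemma 5.6
(`h56`), the Assertion of p. 516 with duality (`hkill`), and Lemma 5.8 (`h58`, the change of the
second Betti number under a modification of type `(3, 3)` of a simply connected `W⁵` bounded by a
homotopy sphere: `NullCobordism.finrank_surgery_ne_of_iso` with the isotropy
`FramedSphereFamily.mul_eq_zero_of_zsmul_parallel_eq_zsmul_meridian`, `k = 2` even) — are theorems
of the tree. What remains hypothetical is the differential topology of §5: `h55` (Thm. 5.5,
`π₁`-killing by framed `1`-surgeries keeping s-parallelizability, via Whitney's embedding theorem)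
and `h534` (Lemmas 5.3–5.4: spherical classes of `H₂` of an s-parallelizable `W⁵` are carried by
framed imbedded `2`-spheres whose modification is again s-parallelizable).
[cite: KervaireMilnorAnnals1963, Thm. 5.1 and its proof for k even (pp. 513–517)] -/
theorem boundsContractible_of_nullCobordism_isStablyParallelizable_four_of_surgeryLemmas_geometric
    (h55 : ∀ (S : HomotopySphere 4) (c : NullCobordism 4 S.carrier), ConnectedSpace c.W →
      IsStablyParallelizable (𝓡∂ (4 + 1)) c.W →
        ∃ c₁ : NullCobordism 4 S.carrier,
          SimplyConnectedSpace c₁.W ∧ IsStablyParallelizable (𝓡∂ (4 + 1)) c₁.W)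
    (h534 : ∀ (S : HomotopySphere 4) (c : NullCobordism 4 S.carrier), SimplyConnectedSpace c.W →
      IsStablyParallelizable (𝓡∂ (4 + 1)) c.W → ∀ x : singularHomology ℤ ℤ c.W 2,
        ∃ (ν : FramedSphereFamily (𝓡∂ (4 + 1)) c.W Unit 2 (2 + 1))
          (θ : singularHomology ℤ ℤ (Metric.sphere (0 : EuclideanSpace ℝ (Fin (2 + 1))) 1) 2),
          zmultiples θ = ⊤ ∧ singularHomology.map ℤ ℤ ν.sphereMap 2 θ = x ∧
            IsStablyParallelizable (𝓡∂ (4 + 1)) (c.surgery ν rfl).W) :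
    boundsContractible_of_nullCobordism_isStablyParallelizable_four :=
  boundsContractible_of_nullCobordism_isStablyParallelizable_four_of_surgeryLemmas_homological h55
    h534 fun S c hsc _ ν => by
      haveI := hsc
      exact NullCobordism.finrank_surgery_ne_of_even le_rfl even_two S c ν

end HomotopySphere

end Literature.Topology.FourManifolds

end
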